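import Literature.NumberTheory.LFunctions.MoebiusAutomaticFinalSyncPrep
import Literature.NumberTheory.LFunctions.MoebiusAutomaticCarry
import HarnessLib

/-!
# Periodic twists of synchronizing automatic sequences are orthogonal to `μ` (Müllner 2017, Lemma 4.11; proved)

Everything in this file is PROVED. Müllner, *Automatic sequences fulfill the Sarnak conjecture*
(Duke Math. J. 166 (2017) = arXiv:1602.03042) disposes of the special representations `D_ℓ` of
the transducer group by Lemma 4.11: after the characterising property
`D_ℓ(T(q₀,(n)_k)) = e(ℓ n/d')` the sum over `n` in a residue class, twisted by this additive
character and cut off by top digits, is a sum of `μ` over (intersections of) arithmetic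
progressions, `= o(N)` by "the well-known result `∑_{n<N, n≡r (s)} μ(n) = o(N)`". In the tree's
labelling-free form of §4 the character `e(ℓ n/d')` comes with a factor depending on the END
STATE `δ(M, (n)_k)` of the naturally induced transducer — a SYNCHRONIZING automaton on the
minimal images — and this file proves the corresponding statement:

* `isLittleO_moebiusSum_mul_dfaoSeq_of_synchronizing` — for a DFAO with a synchronizing digit
  word (the Deshouillers–Drmota–Müllner situation of `MoebiusAutomaticSynchronizing.lean`) and a
  bounded `q`-periodic weight `p`, `∑_{n ≤ N} p(n) a(n) μ(n) = o(N)` (the periodic model of the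
  synchronizing sequence times `p` is `q k^L`-periodic; `μ` is orthogonal to periodic sequences,
  `isLittleO_moebiusSum_of_periodic`, i.e. `μ` in progressions — Siegel–Walfisz);
* `MinImage.isLittleO_moebiusSum_mul_next`, `MinImage.exists_forall_norm_twistedSum_le` — the
  instance for the transducer: for every state `M`, every `τ` on the states with `|τ| ≤ 1` and
  every bounded periodic `p`, `∑_{n<x} p(n) τ(δ(M,(n)_k)) μ(n) = o(x)`, in `ε`–`x₀` form.

## References
* C. Müllner, Duke Math. J. 166 (2017) = arXiv:1602.03042: Lemma 4.11 (p. 22), §3.1.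
  [Mullner2017]
* J.-M. Deshouillers, M. Drmota, C. Müllner, Studia Math. 231 (2015) (synchronizing automata;
  cited through Müllner 2017). [DeshouillersDrmotaMullner2016]
-/

noncomputable section

open Finset Filter Asymptotics
open scoped ArithmeticFunction.Moebius

namespace Literature.NumberTheory.LFunctions

/-! ## Periodic twists of synchronizing automatic sequences -/

/-- **A bounded periodic twist of a synchronizing automatic sequence is orthogonal to `μ`**
(Müllner's Lemma 4.11 in automaton form): for a DFAO read from the most significant base-`k`
digit with a synchronizing digit word `w`, a `q`-periodic `p` (`q ≥ 1`) with `|p| ≤ 1`,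
`∑_{n ≤ N} p(n) a(n) μ(n) = o(N)`. [cite: Mullner2017, Lemma 4.11 / §3.1] -/
theorem isLittleO_moebiusSum_mul_dfaoSeq_of_synchronizing {σ : Type*} [Finite σ] {k : ℕ}
    (hk : 2 ≤ k) (δ : σ → ℕ → σ) (q₀ : σ) (τ : σ → ℂ) {w : List ℕ} (hw : ∀ d ∈ w, d < k)
    {qw : σ} (hsync : ∀ q, w.foldl δ q = qw) {p : ℕ → ℂ} {q : ℕ} (hp : Function.Periodic p q)
    (hq : 0 < q) (hp1 : ∀ n, ‖p n‖ ≤ 1) :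
    moebiusSum (fun n => p n * dfaoSeq k δ q₀ τ n) =o[atTop] fun N : ℕ => (N : ℝ) := by
  have hk1 : 1 < k := hk
  haveI := Fintype.ofFinite σ
  -- a uniform bound for the values
  set B : ℝ := 1 + ∑ q, ‖τ q‖
  have hB0 : 0 < B := by
    have : 0 ≤ ∑ q, ‖τ q‖ := sum_nonneg fun _ _ => norm_nonneg _
    linarith
  have hτ : ∀ q, ‖τ q‖ ≤ B := fun q =>
    (single_le_sum (f := fun q => ‖τ q‖) (fun _ _ => norm_nonneg _) (mem_univ q)).trans
      (by linarith)
  have ha : ∀ n, ‖dfaoSeq k δ q₀ τ n‖ ≤ B := fun n => hτ _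
  refine isLittleO_moebiusSum_of_l1Approx fun ε hε => ?_
  -- choose the level `L`
  obtain ⟨L, hL⟩ := exists_card_syncBad_le hk1 hw (η := ε / (4 * B)) (by positivity)
  set K := k ^ L with hK
  have hKpos : 0 < K := pow_pos (by omega) L
  set b : ℕ → ℂ := fun n => dfaoSeq k δ q₀ τ (n % K + K * 1) with hb
  -- the periodic model of the twisted sequence, period `q K`
  have hpK : Function.Periodic p (q * K) := by
    have := hp.nat_mul K; rwa [mul_comm] at this
  have hbK : Function.Periodic b (q * K) := (periodic_dfaoSeq_mod k L δ q₀ τ).nat_mul q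
  have hpb : Function.Periodic (fun n => p n * b n) (q * K) := hpK.mul hbK
  refine ⟨fun n => p n * b n, isLittleO_moebiusSum_of_periodic hpb (Nat.mul_pos hq hKpos), ?_⟩
  -- the `L¹` distance is supported on `n < K` or bad residues
  set Bad := syncBad k L w
  have hptwise : ∀ n, ‖p n * dfaoSeq k δ q₀ τ n - p n * b n‖ ≤
      (if n < K then 2 * B else 0) + (if n % K ∈ Bad then 2 * B else 0) := by
    intro n
    have hfac : ‖p n * dfaoSeq k δ q₀ τ n - p n * b n‖ ≤ ‖dfaoSeq k δ q₀ τ n - b n‖ := by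
      rw [← mul_sub, norm_mul]
      exact mul_le_of_le_one_left (norm_nonneg _) (hp1 n)
    refine hfac.trans ?_
    have h2B : ‖dfaoSeq k δ q₀ τ n - b n‖ ≤ 2 * B :=
      (norm_sub_le _ _).trans (by linarith [ha n, ha (n % K + K * 1)])
    by_cases h1 : n < K
    · rw [if_pos h1]
      have : 0 ≤ (if n % K ∈ Bad then 2 * B else 0) := by split_ifs <;> linarith
      linarith
    · rw [if_neg h1, zero_add]
      by_cases h2 : n % K ∈ Bad
      · rw [if_pos h2]; exact h2B
      · rw [if_neg h2, dfaoSeq_eq_periodic_model hk1 hsync (not_lt.1 h1) h2, hb, sub_self,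
          norm_zero]
  have hsum : ∀ N : ℕ, ∑ n ∈ range (N + 1), ‖p n * dfaoSeq k δ q₀ τ n - p n * b n‖ ≤
      2 * B * K + 2 * B * (((N / K + 1 : ℕ) : ℝ) * Bad.card) := by
    intro N
    refine (sum_le_sum fun n _ => hptwise n).trans ?_
    rw [sum_add_distrib, ← sum_filter, ← sum_filter, sum_const, sum_const, nsmul_eq_mul,
      nsmul_eq_mul]
    have h2B : (0 : ℝ) ≤ 2 * B := by linarith
    have hc1 : (((range (N + 1)).filter fun n => n < K).card : ℝ) ≤ K := by
      have hsub : ((range (N + 1)).filter fun n => n < K) ⊆ range K := fun n hn => by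
        simp only [mem_filter, mem_range] at hn ⊢
        exact hn.2
      exact_mod_cast (card_le_card hsub).trans_eq (card_range K)
    have hc2 : (((range (N + 1)).filter fun n => n % K ∈ Bad).card : ℝ) ≤
        ((N / K + 1 : ℕ) : ℝ) * Bad.card := by
      exact_mod_cast card_filter_mod_mem_le K Bad N
    have h1 := mul_le_mul_of_nonneg_right hc1 h2B
    have h2 := mul_le_mul_of_nonneg_right hc2 h2B
    linarith
  -- conclude: `2BK + 2B(N/K+1)#Bad ≤ ε N` for large `N`
  have hBadK : 2 * B * (Bad.card : ℝ) / K ≤ ε / 2 := by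
    rw [div_le_iff₀ (by exact_mod_cast hKpos : (0 : ℝ) < K)]
    have := mul_le_mul_of_nonneg_left hL (by linarith : (0 : ℝ) ≤ 2 * B)
    calc 2 * B * (Bad.card : ℝ) ≤ 2 * B * (ε / (4 * B) * (k : ℝ) ^ L) := this
      _ = ε / 2 * K := by rw [hK]; push_cast; field_simp; ring
  set C₀ : ℝ := 2 * B * K + 2 * B * Bad.card with hC₀
  obtain ⟨N₁, hN₁⟩ := exists_nat_gt (2 * C₀ / ε)
  refine eventually_atTop.2 ⟨N₁, fun N hN => (hsum N).trans ?_⟩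
  have hNK : ((N / K : ℕ) : ℝ) ≤ (N : ℝ) / K := Nat.cast_div_le
  have hC₀N : C₀ ≤ ε / 2 * N := by
    have : 2 * C₀ / ε ≤ N := hN₁.le.trans (by exact_mod_cast hN)
    rw [div_le_iff₀ hε] at this
    linarith
  calc 2 * B * (K : ℝ) + 2 * B * (((N / K + 1 : ℕ) : ℝ) * Bad.card)
      = C₀ + (2 * B * Bad.card) * ((N / K : ℕ) : ℝ) := by rw [hC₀]; push_cast; ring
    _ ≤ C₀ + (2 * B * Bad.card) * ((N : ℝ) / K) := by gcongr
    _ = C₀ + (2 * B * (Bad.card : ℝ) / K) * N := by ring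
    _ ≤ ε / 2 * N + ε / 2 * N := add_le_add hC₀N (mul_le_mul_of_nonneg_right hBadK (Nat.cast_nonneg N))
    _ = ε * N := by ring

/-! ## The transducer states as a synchronizing automaton -/

namespace MinImage

variable {σ : Type*} [Fintype σ] [DecidableEq σ] {δ : σ → ℕ → σ} {k : ℕ}

/-- Reading letter by letter: folding `N ↦ δ(N, d)` over `w` is `δ(M, w)`. [folklore] -/
theorem foldl_next_singleton (M : MinImage δ) (w : List ℕ) :
    w.foldl (fun (N : MinImage δ) (d : ℕ) => N.next [d]) M = M.next w := by
  induction w generalizing M with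
  | nil => exact M.next_nil.symm
  | cons d w ih =>
    rw [List.foldl_cons, ih, ← next_append]
    rfl

/-- **The end state of the transducer, twisted by a bounded periodic weight, is orthogonal to
`μ`**: for every state `M`, every `τ` on the states and every `q`-periodic `p` with `|p| ≤ 1`,
`∑_{n ≤ N} p(n) τ(δ(M, (n)_k)) μ(n) = o(N)` — the automaton `N ↦ δ(N, d)` on the minimal images is
synchronizing (a minimising word sends every state to its full image).
[cite: Mullner2017, Lemma 4.11 / Def. 2.1 (property 8)] -/
theorem isLittleO_moebiusSum_mul_next (hk : 2 ≤ k) (htriv : ∀ q d, k ≤ d → δ q d = q)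
    (M : MinImage δ) (τ : MinImage δ → ℂ) {p : ℕ → ℂ} {q : ℕ} (hp : Function.Periodic p q)
    (hq : 0 < q) (hp1 : ∀ n, ‖p n‖ ≤ 1) :
    moebiusSum (fun n => p n * τ (M.next ((Nat.digits k n).reverse))) =o[atTop]
      fun N : ℕ => (N : ℝ) := by
  have hk0 : 0 < k := by omega
  obtain ⟨w₀, hw₀d, -, hw₀⟩ := exists_sync_digit_word (δ := δ) htriv hk0
  have hsync : ∀ N : MinImage δ, w₀.foldl (fun (N : MinImage δ) (d : ℕ) => N.next [d]) N =
      M.next w₀ := fun N => by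
    rw [foldl_next_singleton, next_eq_of_card_eq N M hw₀]
  have h := isLittleO_moebiusSum_mul_dfaoSeq_of_synchronizing hk
    (fun (N : MinImage δ) (d : ℕ) => N.next [d]) M τ hw₀d hsync hp hq hp1
  have e : (fun n => p n * dfaoSeq k (fun (N : MinImage δ) (d : ℕ) => N.next [d]) M τ n) =
      fun n => p n * τ (M.next ((Nat.digits k n).reverse)) := by
    funext n
    rw [dfaoSeq, foldl_next_singleton]
  rwa [e] at h

/-- **`ε`–`x₀` form**: for every `ε > 0`, for all large `x`,
`|∑_{n<x} p(n) τ(δ(M,(n)_k)) μ(n)| ≤ ε x` (`|τ| ≤ 1`, `p` bounded `q`-periodic).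
[cite: Mullner2017, Lemma 4.11] -/
theorem exists_forall_norm_twistedSum_le (hk : 2 ≤ k) (htriv : ∀ q d, k ≤ d → δ q d = q)
    (M : MinImage δ) {τ : MinImage δ → ℂ} (hτ1 : ∀ N, ‖τ N‖ ≤ 1) {p : ℕ → ℂ} {q : ℕ}
    (hp : Function.Periodic p q) (hq : 0 < q) (hp1 : ∀ n, ‖p n‖ ≤ 1) {ε : ℝ} (hε : 0 < ε) :
    ∃ x₀ : ℕ, ∀ x : ℕ, x₀ ≤ x →
      ‖∑ n ∈ range x, p n * τ (M.next ((Nat.digits k n).reverse)) * (μ n : ℂ)‖ ≤ ε * x := by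
  have hb : ∀ n, ‖p n * τ (M.next ((Nat.digits k n).reverse))‖ ≤ 1 := fun n => by
    rw [norm_mul]
    exact mul_le_one₀ (hp1 n) (norm_nonneg _) (hτ1 _)
  obtain ⟨N₀, hN₀⟩ :=
    exists_forall_norm_sum_range_le (M.isLittleO_moebiusSum_mul_next hk htriv τ hp hq hp1) hb hε
  exact ⟨N₀, fun x hx => hN₀ x hx x (Nat.le_succ x)⟩

end MinImage

end Literature.NumberTheory.LFunctions
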